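import Summits.Ventures.PercRepro.MS3Regime

/-!
# The three-colour Marica–Schönheim statement with only two types

If no pair of `T` avoids colour `i` (`avoidMembers T κ i = ∅`), then every pair has exactly one
member of colour `i`, `|T| = 2 |C_i|`, and `|C_i| ≤ |C_i \\ C_i| ≤ |classDiffs T κ|` by
Marica–Schönheim: `|T| ≤ 2 |classDiffs T κ|` with no further hypothesis
(`msr3_card_le_of_avoidMembers_eq_empty`). Together with `msr3_card_le_of_small_type`
(one pair avoiding `i`, down-closed `C_i`) and `msr3_card_le_of_bot_mem` (the pair `{⊥, ⊤}`
touched) these are the kernel pieces of the ≤ 1-pair regime of `MS3`.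
-/

namespace PercRepro

open Finset
open scoped FinsetFamily

variable {S : Type} [Fintype S] [DecidableEq S]

omit [DecidableEq S] in
/-- **Two types**: if no pair avoids colour `i`, then `|T| ≤ 2 |classDiffs T κ|`. -/
theorem msr3_card_le_of_avoidMembers_eq_empty (T : Finset (Config S)) (κ : Config S → Fin 3)
    (hT : ∀ A ∈ T, Aᶜ ∈ T) (hκ : ∀ A ∈ T, κ Aᶜ ≠ κ A) (i : Fin 3)
    (hP : avoidMembers T κ i = ∅) : T.card ≤ 2 * (classDiffs T κ).card := by
  have hcount := card_eq_two_mul_colourMembers_add T κ hT hκ i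
  rw [hP, Finset.card_empty, add_zero] at hcount
  have hsub : colourMembers T κ i \\ colourMembers T κ i ⊆ classDiffs T κ := by
    intro E hE
    obtain ⟨A, hA, B, hB, rfl⟩ := Finset.mem_diffs.1 hE
    simp only [colourMembers, Finset.mem_filter] at hA hB
    exact sdiff_mem_classDiffs hA.1 hB.1 (hA.2.trans hB.2.symm)
  have hMS : (colourMembers T κ i).card ≤ (colourMembers T κ i \\ colourMembers T κ i).card :=
    Finset.card_le_card_diffs _
  rw [hcount]
  have := hMS.trans (Finset.card_le_card hsub)
  omega

end PercRepro
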